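import Summits.QuantumFields.YangMills.Theorems.BalabanUVNodesN15KingModelAnalyticDeterminantRealSlice
import Literature.LinearAlgebra.Matrix.ChordalMaximumDeterminantCompletion
import Literature.LinearAlgebra.Matrix.LoewnerOrderPairFacts
import Literature.LinearAlgebra.Matrix.DensityMatrixUncertainty
import HarnessLib

/-!
# BalabanUVNodes ∕ N15 — THE KING-MODEL RUNG (PART Ϭ-k): THE THREE NORMALISATIONS ARE MONOTONE IN THE MASS AND IN THE BLOCK COUPLING AT EVERY BACKGROUND — Loewner order all the way:
# `m₁² ≤ m₂²` ⟹ `B(U;m₁²) ≤ B(U;m₂²)` ⟹ `B(U;m₂²)⁻¹ ≤ B(U;m₁²)⁻¹` (Bernstein Fact 8.10.8) ⟹ `C(U;m₂²) ≤ C(U;m₁²)` (congruence by Bałaban's `Q(U)`) ⟹ `Δ_eff(U;m₁²) ≤ Δ_eff(U;m₂²)` ⟹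
# `ln det Δ_eff(U;m₁²) ≤ ln det Δ_eff(U;m₂²)` (concavity of `ln det` + [HJ] 7.2.P26 (a) `tr(XP) ≥ 0`); likewise `a₁ ≤ a₂` ⟹ `Δ_eff(U;a₁) ≤ Δ_eff(U;a₂)`, and `A₀(U)` is Loewner-increasing in both — so along
# King's running parameters (`a_k`, the scale-dependent masses of (2.13)–(2.14) p.653) the block-field and fine normalisations are ordered, at every unitary background, for every contour system and fibre
# (Track A, DAG node N15 = NE2; FAN-OUT v1.1 §N15 s3 «KING-MODEL RUNG … + what the curved case adds»; count-neutral)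

HONEST FRAMING.  Count-neutral (cell `pub-ymgap`, seat `pub-ymgap-dag-n15-e` g53; `--supports stmt-QuantumFields-27247 --as helper` = K3ᴬ, KEY MAP v3).  King's one-level comparison model at
unitary backgrounds, any `RCLike` fibre (nonempty), `a > 0`, `m² > 0`, `c ≥ 0`; order-theoretic bookkeeping with the tree's Loewner-order library — no new estimate.  NOT Bałaban's multi-level
`Z_k`; NOT a node discharge (N15 of record untouched); nothing continuum ∕ ℝ⁴ ∕ OS ∕ Clay.

THE RESULTS (unitary `U`; `B(m²) = −cΔ_U+m²`, `C = (Δ_eff)⁻¹`, `A₀ = B + aQ^*Q`):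
* §1 (generic) ★ `posSemidef_inv_sub_inv_add_of_posSemidef` (`A ≻ 0`, `P ⪰ 0` ⟹ `A⁻¹ − (A+P)⁻¹ ⪰ 0` — Bernstein 8.10.8 by name), ★★ `log_re_det_mono` (`A, B ≻ 0`, `B − A ⪰ 0` ⟹ `ln det A ≤ ln det B` — concavity
  `ChordalSparsity.log_det_sub_log_det_le` + `DensityMatrixUncertainty.re_trace_mul_nonneg`).
* §2 MASS: `covLapF_sub_covLapF_mass` (`B(m₂²) − B(m₁²) = (m₂²−m₁²)·1`), `posSemidef_covLapF_inv_sub_mass` (`B(m₁²)⁻¹ − B(m₂²)⁻¹ ⪰ 0`), ★★ `posSemidef_effLapU_inv_sub_mass` (`C(m₁²) − C(m₂²) ⪰ 0`),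
  ★★★ **`posSemidef_effLapU_sub_mass`** (`Δ_eff(U;m₂²) − Δ_eff(U;m₁²) ⪰ 0`), ★★★ **`log_re_det_effLapU_mono_mass`**, ★★ `log_re_det_covLapF_mono_mass`, ★★ `log_re_det_fullOpU_mono_mass`.
* §3 COUPLING: ★★ `posSemidef_effLapU_inv_sub_coupling` (`a₁ ≤ a₂` ⟹ `C(a₁) − C(a₂) = (a₁⁻¹ − a₂⁻¹)·1 ⪰ 0`), ★★★ **`posSemidef_effLapU_sub_coupling`** (`Δ_eff(U;a₂) − Δ_eff(U;a₁) ⪰ 0`),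
  ★★★ **`log_re_det_effLapU_mono_coupling`**, `fullOpU_sub_fullOpU_coupling`, ★★ `log_re_det_fullOpU_mono_coupling`.
PRIOR TREE ART (by name): Literature `LoewnerPairFacts.posSemidef_inv_sub_inv_add` ([Bernstein2009] Fact 8.10.8), `ChordalSparsity.log_det_sub_log_det_le` ([VBW98]), `DensityMatrixUncertainty.re_trace_mul_nonneg`
([HJ] 7.2.P26 (a)), Ϥ-k (`effLapU_inv_eq_noise_add_blockAvg`, `isUnit_effLapU`, `posDef_fullOpU_massive`), Ϭ-b (`posDef_effLapU`), Ͱ-a (`covLapF_eq`, `posDef_covLapF`), Mathlib (`Matrix.PosSemidef.mul_mul_conjTranspose_same`,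
`Matrix.PosSemidef.smul`, `Matrix.PosSemidef.one`, `Matrix.nonsing_inv_nonsing_inv`).  Dedup (rg at filing): basename 0 files; needles
`log_re_det_mono|posSemidef_effLapU_sub_mass|log_re_det_effLapU_mono_mass|posSemidef_effLapU_sub_coupling|log_re_det_effLapU_mono_coupling` 0 tree files.  Locators: [King1986] (2.13)–(2.14) p.653 (`a_k` defined after (2.13)), (3.89)–(3.90) pp.668–669; [Bernstein2009] Fact 8.10.8 (held chunk p0484); [HornJohnson2013] 7.2.P26 (a) (held chunk p0547); [VandenbergheBoydWu1998] §3 (3.2).  0 `sorry`, 0 `def`.  v1.1 (DOC-ONLY, ERRATUM-Ϭ3, self-caught): v1.0 cited King «(3.2) p.657» for the mass flow and «(2.7) p.652» for `a_k` —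
(3.2) is the field bound on p.655 and `a_k` is defined on p.653 after (2.13); corrected to (2.13)–(2.14) p.653; declarations byte-identical.
-/

noncomputable section
open scoped BigOperators ComplexConjugate ComplexOrder Matrix.Norms.L2Operator
open Finset Matrix

namespace Summit.QuantumFields.YangMills.BalabanUVNodes.N15KingModelRung.Analytic

open Literature.MathematicalPhysics.QuantumFieldTheory.Balaban1983to89.B5Prop11Plancherel (Tor fine)
open Literature.LinearAlgebra.Matrix.LoewnerPairFacts (posSemidef_inv_sub_inv_add)
open Literature.LinearAlgebra.Matrix.ChordalSparsity (log_det_sub_log_det_le)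
open Literature.LinearAlgebra.Matrix.DensityMatrixUncertainty (re_trace_mul_nonneg)
open Summit.QuantumFields.YangMills.BalabanUVNodes.N15KingModelRung.Covariant (covLapF covLapF_eq posDef_covLapF kingHopping)
open Summit.QuantumFields.YangMills.BalabanUVNodes.N15KingModelRung.CovariantBlock (BlockTree covQ kingQadjU fullOpU effLapU effLapU_inv_eq_noise_add_blockAvg isUnit_effLapU
  posDef_fullOpU_massive)

/-! ## §1 Two generic Loewner facts -/

section Generic

variable {𝕜 : Type*} [RCLike 𝕜] {ι : Type*} [Fintype ι] [DecidableEq ι]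

/-- ★ **THE INVERSE IS LOEWNER-ANTITONE**: `A ≻ 0`, `P ⪰ 0` ⟹ `A⁻¹ − (A + P)⁻¹ ⪰ 0` (Bernstein's Fact 8.10.8 `A⁻¹ − ((A+P)⁻¹ + (A+P)⁻¹P(A+P)⁻¹) ⪰ 0` plus `(A+P)⁻¹P(A+P)⁻¹ ⪰ 0`).
[cite: Bernstein2009, Fact 8.10.8 (held chunk p0484)] -/
theorem posSemidef_inv_sub_inv_add_of_posSemidef {A P : Matrix ι ι 𝕜} (hA : A.PosDef) (hP : P.PosSemidef) : (A⁻¹ - (A + P)⁻¹).PosSemidef := by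
  have hAP : (A + P).PosDef := hA.add_posSemidef hP
  have hAPu : IsUnit (A + P).det := isUnit_iff_ne_zero.mpr hAP.det_pos.ne'
  have h1 := posSemidef_inv_sub_inv_add hA hP.1 hAPu
  have hKH : ((A + P)⁻¹)ᴴ = (A + P)⁻¹ := by rw [conjTranspose_nonsing_inv, hAP.1.eq]
  have h2 : ((A + P)⁻¹ * P * (A + P)⁻¹).PosSemidef := by
    have h := hP.mul_mul_conjTranspose_same (A + P)⁻¹
    rwa [hKH] at h
  have h3 := h1.add h2
  have e : A⁻¹ - ((A + P)⁻¹ + (A + P)⁻¹ * P * (A + P)⁻¹) + (A + P)⁻¹ * P * (A + P)⁻¹ = A⁻¹ - (A + P)⁻¹ := by abel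
  rwa [e] at h3

/-- ★★ **`ln det` IS LOEWNER-MONOTONE ON THE POSITIVE CONE**: `A, B ≻ 0`, `B − A ⪰ 0` ⟹ `ln det A ≤ ln det B` (concavity: `ln det A − ln det B ≤ Re tr(B⁻¹(A − B)) = −Re tr(B⁻¹(B − A)) ≤ 0`,
[HJ] 7.2.P26 (a)). [cite: HornJohnson2013, 7.2.P26 (a) (held chunk p0547); VandenbergheBoydWu1998, §3 eq. (3.2)] -/
theorem log_re_det_mono {A B : Matrix ι ι 𝕜} (hA : A.PosDef) (hB : B.PosDef) (hBA : (B - A).PosSemidef) :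
    Real.log (RCLike.re A.det) ≤ Real.log (RCLike.re B.det) := by
  have h := (log_det_sub_log_det_le hB hA).1
  have hBu : IsUnit B.det := isUnit_iff_ne_zero.mpr hB.det_pos.ne'
  have htr : RCLike.re ((B⁻¹ * A).trace) - Fintype.card ι = -RCLike.re ((B⁻¹ * (B - A)).trace) := by
    rw [Matrix.mul_sub, Matrix.nonsing_inv_mul _ hBu, Matrix.trace_sub, Matrix.trace_one, map_sub, RCLike.natCast_re]
    ring
  have hnn := re_trace_mul_nonneg hB.inv.posSemidef hBA
  linarith

end Generic

variable {d : ℕ} {L : ℕ} [NeZero L] (T : BlockTree d L) (M : Fin (d + 1) → ℕ) [hM : ∀ μ, NeZero (M μ)]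
variable {𝕜 : Type*} [RCLike 𝕜] {n : Type*} [Fintype n] [DecidableEq n]

/-! ## §2 Monotonicity in the mass -/

section Mass

variable {a c m1 m2 : ℝ} (ha : 0 < a) (hc : 0 ≤ c) (hm1 : 0 < m1) (h12 : m1 ≤ m2)
variable {U : Tor (fine L M) × Fin (d + 1) → Matrix n n 𝕜} (hU : ∀ bd, U bd ∈ Matrix.unitaryGroup n 𝕜)

omit [Fintype n] in
/-- `B(m₂²) − B(m₁²) = (m₂² − m₁²)·1` (the hopping part does not depend on the mass). [cite: King1986, (2.13) p.653, (4.4) p.670] -/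
theorem covLapF_sub_covLapF_mass (c m1 m2 : ℝ) (U : Tor (fine L M) × Fin (d + 1) → Matrix n n 𝕜) :
    covLapF (fine L M) c m2 U - covLapF (fine L M) c m1 U = (((m2 - m1 : ℝ)) : 𝕜) • (1 : Matrix (Tor (fine L M) × n) (Tor (fine L M) × n) 𝕜) := by
  rw [covLapF_eq, covLapF_eq, show (kingHopping (fine L M) c m1).hop U = (kingHopping (fine L M) c m2).hop U from rfl, sub_sub_sub_cancel_right, diagonal_sub,
    ← diagonal_one, ← diagonal_smul]
  congr 1
  funext p
  simp only [Pi.smul_apply, smul_eq_mul, mul_one]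
  push_cast
  ring

include hc hm1 h12 hU

/-- `B(m₁²)⁻¹ − B(m₂²)⁻¹ ⪰ 0`. [cite: Bernstein2009, Fact 8.10.8 (held chunk p0484); King1986, (2.13) p.653] -/
theorem posSemidef_covLapF_inv_sub_mass : ((covLapF (fine L M) c m1 U)⁻¹ - (covLapF (fine L M) c m2 U)⁻¹).PosSemidef := by
  have hP : ((((m2 - m1 : ℝ)) : 𝕜) • (1 : Matrix (Tor (fine L M) × n) (Tor (fine L M) × n) 𝕜)).PosSemidef :=
    Matrix.PosSemidef.one.smul (RCLike.ofReal_nonneg.mpr (by linarith))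
  have h := posSemidef_inv_sub_inv_add_of_posSemidef (posDef_covLapF (fine L M) hc hm1 hU) hP
  have e : covLapF (fine L M) c m1 U + (((m2 - m1 : ℝ)) : 𝕜) • (1 : Matrix (Tor (fine L M) × n) (Tor (fine L M) × n) 𝕜) = covLapF (fine L M) c m2 U := by
    rw [← covLapF_sub_covLapF_mass M c m1 m2 U]; abel
  rw [e] at h
  exact h

include ha

/-- ★★ **`C(U;m₁²) − C(U;m₂²) ⪰ 0`** — NE2's unit layer decreases with the mass (congruence of `B⁻¹` by Bałaban's `Q(U)`: `C = a⁻¹1 + L^{d+1}Q B⁻¹ Qᴴ`). [cite: King1986, (2.14) p.653, (4.44)–(4.45) p.675] -/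
theorem posSemidef_effLapU_inv_sub_mass : ((effLapU T M a c m1 U)⁻¹ - (effLapU T M a c m2 U)⁻¹).PosSemidef := by
  rw [effLapU_inv_eq_noise_add_blockAvg T M ha hc hm1 hU, effLapU_inv_eq_noise_add_blockAvg T M ha hc (lt_of_lt_of_le hm1 h12) hU, add_sub_add_left_eq_sub, kingQadjU,
    Matrix.mul_smul, Matrix.mul_smul, ← smul_sub, ← Matrix.sub_mul, ← Matrix.mul_sub]
  have hL : (0 : 𝕜) ≤ (L : 𝕜) ^ (d + 1) := by
    have : ((L : 𝕜) ^ (d + 1)) = (((L : ℝ) ^ (d + 1) : ℝ) : 𝕜) := by push_cast; ring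
    rw [this]; exact RCLike.ofReal_nonneg.mpr (by positivity)
  exact ((posSemidef_covLapF_inv_sub_mass M hc hm1 h12 hU).mul_mul_conjTranspose_same (covQ T M U)).smul hL

/-- ★★★ **`Δ_eff(U;m₂²) − Δ_eff(U;m₁²) ⪰ 0`** — KING's EFFECTIVE LAPLACIAN INCREASES WITH THE MASS at every unitary background. [cite: King1986, (2.14) p.653, (2.13)–(2.14) p.653; Bernstein2009, Fact 8.10.8 (held chunk p0484)] -/
theorem posSemidef_effLapU_sub_mass [Nonempty n] : (effLapU T M a c m2 U - effLapU T M a c m1 U).PosSemidef := by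
  have hm2 : 0 < m2 := lt_of_lt_of_le hm1 h12
  set C1 := (effLapU T M a c m1 U)⁻¹ with hC1
  set C2 := (effLapU T M a c m2 U)⁻¹ with hC2
  have hC2pd : C2.PosDef := (posDef_effLapU T M ha hc hm2 hU).inv
  have hP : (C1 - C2).PosSemidef := posSemidef_effLapU_inv_sub_mass T M ha hc hm1 h12 hU
  have h := posSemidef_inv_sub_inv_add_of_posSemidef hC2pd hP
  have e1 : C2 + (C1 - C2) = C1 := by abel
  rw [e1, hC2, hC1, Matrix.nonsing_inv_nonsing_inv _ ((Matrix.isUnit_iff_isUnit_det _).mp (isUnit_effLapU T M ha hc hm2 hU)),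
    Matrix.nonsing_inv_nonsing_inv _ ((Matrix.isUnit_iff_isUnit_det _).mp (isUnit_effLapU T M ha hc hm1 hU))] at h
  exact h

/-- ★★★ **THE BLOCK-FIELD NORMALISATION INCREASES WITH THE MASS**: `m₁² ≤ m₂²` ⟹ `ln det Δ_eff(U;m₁²) ≤ ln det Δ_eff(U;m₂²)` at every unitary background — a larger mass lowers the
block-field Gaussian integral `𝒩 ∝ det^{−1∕2}`. [cite: King1986, (2.14) p.653, (3.89)–(3.90) pp.668–669; HornJohnson2013, 7.2.P26 (a) (held chunk p0547)] -/
theorem log_re_det_effLapU_mono_mass [Nonempty n] :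
    Real.log (RCLike.re (effLapU T M a c m1 U).det) ≤ Real.log (RCLike.re (effLapU T M a c m2 U).det) :=
  log_re_det_mono (posDef_effLapU T M ha hc hm1 hU) (posDef_effLapU T M ha hc (lt_of_lt_of_le hm1 h12) hU) (posSemidef_effLapU_sub_mass T M ha hc hm1 h12 hU)

omit ha in
/-- ★★ **THE MINIMALLY COUPLED FINE NORMALISATION INCREASES WITH THE MASS**: `ln det B(U;m₁²) ≤ ln det B(U;m₂²)`. [cite: King1986, (2.13) p.653, (2.13)–(2.14) p.653] -/
theorem log_re_det_covLapF_mono_mass :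
    Real.log (RCLike.re (covLapF (fine L M) c m1 U).det) ≤ Real.log (RCLike.re (covLapF (fine L M) c m2 U).det) := by
  refine log_re_det_mono (posDef_covLapF (fine L M) hc hm1 hU) (posDef_covLapF (fine L M) hc (lt_of_lt_of_le hm1 h12) hU) ?_
  rw [covLapF_sub_covLapF_mass M c m1 m2 U]
  exact Matrix.PosSemidef.one.smul (RCLike.ofReal_nonneg.mpr (by linarith))

/-- ★★ **THE FINE NORMALISATION WITH THE BLOCK TERM INCREASES WITH THE MASS**: `ln det A₀(U;m₁²) ≤ ln det A₀(U;m₂²)`. [cite: King1986, (2.13) p.653, (3.90) p.669] -/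
theorem log_re_det_fullOpU_mono_mass :
    Real.log (RCLike.re (fullOpU T M a c m1 U).det) ≤ Real.log (RCLike.re (fullOpU T M a c m2 U).det) := by
  refine log_re_det_mono (posDef_fullOpU_massive T M ha.le hc hm1 hU) (posDef_fullOpU_massive T M ha.le hc (lt_of_lt_of_le hm1 h12) hU) ?_
  rw [fullOpU, fullOpU, add_sub_add_right_eq_sub, covLapF_sub_covLapF_mass M c m1 m2 U]
  exact Matrix.PosSemidef.one.smul (RCLike.ofReal_nonneg.mpr (by linarith))

end Mass

/-! ## §3 Monotonicity in the block coupling -/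

section Coupling

variable {a1 a2 c m2 : ℝ} (ha1 : 0 < a1) (h12 : a1 ≤ a2) (hc : 0 ≤ c) (hm : 0 < m2)
variable {U : Tor (fine L M) × Fin (d + 1) → Matrix n n 𝕜} (hU : ∀ bd, U bd ∈ Matrix.unitaryGroup n 𝕜)
include ha1 h12 hc hm hU

/-- ★★ **`C(U;a₁) − C(U;a₂) = (a₁⁻¹ − a₂⁻¹)·1 ⪰ 0`** — only the block-spin noise depends on the coupling. [cite: King1986, (2.14) p.653, (4.44)–(4.45) p.675] -/
theorem posSemidef_effLapU_inv_sub_coupling : ((effLapU T M a1 c m2 U)⁻¹ - (effLapU T M a2 c m2 U)⁻¹).PosSemidef := by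
  have ha2 : 0 < a2 := lt_of_lt_of_le ha1 h12
  rw [effLapU_inv_eq_noise_add_blockAvg T M ha1 hc hm hU, effLapU_inv_eq_noise_add_blockAvg T M ha2 hc hm hU, add_sub_add_right_eq_sub, ← sub_smul,
    show ((a1⁻¹ : 𝕜) - (a2⁻¹ : 𝕜)) = (((a1⁻¹ - a2⁻¹ : ℝ)) : 𝕜) by push_cast; ring]
  refine Matrix.PosSemidef.one.smul (RCLike.ofReal_nonneg.mpr ?_)
  rw [sub_nonneg]
  exact (inv_le_inv₀ ha2 ha1).mpr h12

/-- ★★★ **`Δ_eff(U;a₂) − Δ_eff(U;a₁) ⪰ 0`** — KING's EFFECTIVE LAPLACIAN INCREASES WITH THE BLOCK COUPLING at every unitary background. [cite: King1986, (2.14) p.653; Bernstein2009, Fact 8.10.8 (held chunk p0484)] -/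
theorem posSemidef_effLapU_sub_coupling [Nonempty n] : (effLapU T M a2 c m2 U - effLapU T M a1 c m2 U).PosSemidef := by
  have ha2 : 0 < a2 := lt_of_lt_of_le ha1 h12
  set C1 := (effLapU T M a1 c m2 U)⁻¹ with hC1
  set C2 := (effLapU T M a2 c m2 U)⁻¹ with hC2
  have hC2pd : C2.PosDef := (posDef_effLapU T M ha2 hc hm hU).inv
  have hP : (C1 - C2).PosSemidef := posSemidef_effLapU_inv_sub_coupling T M ha1 h12 hc hm hU
  have h := posSemidef_inv_sub_inv_add_of_posSemidef hC2pd hP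
  have e1 : C2 + (C1 - C2) = C1 := by abel
  rw [e1, hC2, hC1, Matrix.nonsing_inv_nonsing_inv _ ((Matrix.isUnit_iff_isUnit_det _).mp (isUnit_effLapU T M ha2 hc hm hU)),
    Matrix.nonsing_inv_nonsing_inv _ ((Matrix.isUnit_iff_isUnit_det _).mp (isUnit_effLapU T M ha1 hc hm hU))] at h
  exact h

/-- ★★★ **THE BLOCK-FIELD NORMALISATION INCREASES WITH THE BLOCK COUPLING**: `a₁ ≤ a₂` ⟹ `ln det Δ_eff(U;a₁) ≤ ln det Δ_eff(U;a₂)` at every unitary background (King's running `a_k = a(1−L⁻²)(1−L^{−2k})⁻¹`, p.653 after (2.13)).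
[cite: King1986, (2.13)–(2.14) p.653, (3.89)–(3.90) pp.668–669; HornJohnson2013, 7.2.P26 (a) (held chunk p0547)] -/
theorem log_re_det_effLapU_mono_coupling [Nonempty n] :
    Real.log (RCLike.re (effLapU T M a1 c m2 U).det) ≤ Real.log (RCLike.re (effLapU T M a2 c m2 U).det) :=
  log_re_det_mono (posDef_effLapU T M ha1 hc hm hU) (posDef_effLapU T M (lt_of_lt_of_le ha1 h12) hc hm hU) (posSemidef_effLapU_sub_coupling T M ha1 h12 hc hm hU)

omit ha1 h12 hc hm hU in
/-- `A₀(U;a₂) − A₀(U;a₁) = (a₂−a₁)L^{d+1}·Q(U)ᴴQ(U)`. [cite: King1986, (2.13) p.653] -/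
theorem fullOpU_sub_fullOpU_coupling (a1 a2 c m2 : ℝ) (U : Tor (fine L M) × Fin (d + 1) → Matrix n n 𝕜) :
    fullOpU T M a2 c m2 U - fullOpU T M a1 c m2 U = ((((a2 - a1) * (L : ℝ) ^ (d + 1) : ℝ)) : 𝕜) • ((covQ T M U)ᴴ * covQ T M U) := by
  rw [fullOpU, fullOpU, add_sub_add_left_eq_sub, ← sub_smul]
  congr 1
  push_cast
  ring

/-- ★★ **THE FINE NORMALISATION WITH THE BLOCK TERM INCREASES WITH THE COUPLING**: `ln det A₀(U;a₁) ≤ ln det A₀(U;a₂)`. [cite: King1986, (2.13)–(2.14) p.653, (3.90) p.669] -/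
theorem log_re_det_fullOpU_mono_coupling :
    Real.log (RCLike.re (fullOpU T M a1 c m2 U).det) ≤ Real.log (RCLike.re (fullOpU T M a2 c m2 U).det) := by
  refine log_re_det_mono (posDef_fullOpU_massive T M ha1.le hc hm hU) (posDef_fullOpU_massive T M (lt_of_lt_of_le ha1 h12).le hc hm hU) ?_
  rw [fullOpU_sub_fullOpU_coupling]
  have hQ : ((covQ T M U)ᴴ * covQ T M U).PosSemidef := Matrix.posSemidef_conjTranspose_mul_self _
  exact hQ.smul (RCLike.ofReal_nonneg.mpr (mul_nonneg (by linarith) (by positivity)))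

end Coupling

end Summit.QuantumFields.YangMills.BalabanUVNodes.N15KingModelRung.Analytic

end
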